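import Literature.Analysis.FluidPDE.NSForcedH1Continuation
import Literature.Analysis.FluidPDE.NSForcedLerayRate
import Literature.Analysis.FluidPDE.NSWeakStrongUniquenessProofs
import Literature.Analysis.FluidPDE.WholeSpaceIBP
import HarnessLib

/-!
# The forced `H¹` continuation criterion follows from the forced Leray rate

Analysis/FluidPDE proof file (no definitions, no named facts). The tree vendors two forced
endpoint statements of P. G. Lemarié-Rieusset, *The Navier–Stokes Problem in the 21st Century*
(CRC Press 2016) as named facts for the cell `ns-blowup`:

* `lemarieRieusset2016_lerayRate_forced` (`NSForcedLerayRate.lean`; Thm. 11.4 "Leray's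
  criterion", p. 327): for a maximal classical solution with Clay data,
  `liminf_{t → T⁻} (T - t)^{(1-3/q)/2} ‖u(t)‖_{L^q} ≥ C(ν,q) > 0` for every `3 < q < ∞`;
* `lemarieRieusset2016_H1_continuation_forced` (`NSForcedH1Continuation.lean`; Thm. 7.2 first
  point, p. 125): a classical solution of the same class whose enstrophy stays bounded up to `T`
  extends classically past `T`.

This file PROVES that the first implies the second, so that the two are not independent debts:

* `lemarieRieusset2016_H1_continuation_forced_of_lerayRate`.

## The argument (Leray 1934, §20/§22; Lemarié-Rieusset 2016, p. 327: Thm. 11.4 with `q = 6`)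

Suppose the enstrophy is bounded, `∫ |∇u(t)|² ≤ B` on `[0, T)`, but `u` has no classical extension
past `T`. Then `(u, p)` is a maximal smooth solution (`IsMaximalSmoothSolution`), and Leray's rate
with `q = 6` gives `liminf_{t → T⁻} (T - t)^{1/4} ‖u(t)‖_{L⁶} ≥ C > 0`. By the Sobolev embedding
`H¹(ℝ³) ⊂ L⁶(ℝ³)` (tree: `exists_eLpNorm_six_le_of_hasWeakGradient_euclidean`, Robinson–Rodrigo–
Sadowski 2016 Thm. 1.7 (i), applied to the smooth finite-energy slices through
`hasWeakGradient_fderiv_of_contDiff`) `‖u(t)‖_{L⁶} ≤ K √B` on `[0, T)`, so the quantity inside the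
`liminf` is `≤ K √B (T - t)^{1/4} → 0`: contradiction.

## Mathlib / tree search

`lean search 'of_lerayRate|lerayRate_forced'` — only `NSForcedLerayRate.lean` (the fact and its
`liminf_ne_zero` corollary); no implication between the two facts before this file. Reused:
`exists_eLpNorm_six_le_of_hasWeakGradient_euclidean` (`NSWeakStrongUniquenessProofs`),
`hasWeakGradient_fderiv_of_contDiff` (`WholeSpaceIBP`), `IsClassicalNSSolutionOn.contDiff_velocity`.

## References

* P. G. Lemarié-Rieusset, *The Navier–Stokes Problem in the 21st Century*, CRC Press (2016):
  Thm. 11.4 (p. 327), Thm. 7.2 (p. 125). [LemarieRieusset2016]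
* J. Leray, *Sur le mouvement d'un liquide visqueux emplissant l'espace*, Acta Math. 63 (1934),
  §20 (the `‖∇u‖₂ ≥ c (T - t)^{-1/4}` form of the rate). [Leray1934]
* J. C. Robinson, J. L. Rodrigo, W. Sadowski, *The Three-Dimensional Navier–Stokes Equations*,
  CUP (2016), Thm. 1.7 (i) (`H¹ ⊂ L⁶`). [RobinsonRodrigoSadowski2016]
-/

noncomputable section

open MeasureTheory Set Function Filter Topology
open scoped ENNReal NNReal

namespace Literature.Analysis.FluidPDE

/-- **Uniform `L⁶` bound from a uniform enstrophy bound** (Sobolev `H¹(ℝ³) ⊂ L⁶(ℝ³)` slice by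
slice): for a classical solution on `[0, T)` with finite energy on every closed sub-slab and
`∫ |∇u(t)|² ≤ B` on `[0, T)`, there is a finite `M` with `‖u(t)‖_{L⁶} ≤ M` for all `t ∈ [0, T)`.
[cite: RobinsonRodrigoSadowski2016, Thm. 1.7 (i)] -/
theorem exists_eLpNorm_six_le_of_enstrophy_le {ν T : ℝ}
    {f u : ℝ → EuclideanSpace ℝ (Fin 3) → EuclideanSpace ℝ (Fin 3)}
    {p : ℝ → EuclideanSpace ℝ (Fin 3) → ℝ}
    (hsol : IsClassicalNSSolutionOn (Ico 0 T) ν f u p)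
    (hE : ∀ T' ∈ Ioo 0 T, ∃ C : ℝ≥0∞, C < ⊤ ∧ ∀ t ∈ Icc 0 T', ∫⁻ x, ‖u t x‖ₑ ^ 2 ≤ C)
    {B : ℝ≥0} (hB : ∀ t ∈ Ico 0 T,
      ∫⁻ x, ENNReal.ofReal (FluidPDE.frobeniusNormSq (fderiv ℝ (u t) x)) ≤ B) :
    ∃ M : ℝ≥0∞, M ≠ ⊤ ∧ ∀ t ∈ Ico 0 T, eLpNorm (u t) 6 volume ≤ M := by
  obtain ⟨K, hK⟩ := exists_eLpNorm_six_le_of_hasWeakGradient_euclidean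
  refine ⟨(K : ℝ≥0∞) * (B : ℝ≥0∞) ^ (1 / 2 : ℝ),
    ENNReal.mul_ne_top ENNReal.coe_ne_top
      (ENNReal.rpow_ne_top_of_nonneg (by norm_num) ENNReal.coe_ne_top), fun t ht => ?_⟩
  have hcont : ContDiff ℝ 1 (u t) := contDiff_infty.1 (hsol.contDiff_velocity ht) 1
  have hT' : (t + T) / 2 ∈ Ioo 0 T := ⟨by linarith [ht.1, ht.2], by linarith [ht.2]⟩
  obtain ⟨C₂, hC₂, hEb⟩ := hE _ hT'
  have htI : t ∈ Icc 0 ((t + T) / 2) := ⟨ht.1, by linarith [ht.2]⟩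
  have h2 : MemLp (u t) 2 volume := by
    refine ⟨hcont.continuous.aestronglyMeasurable, ?_⟩
    rw [eLpNorm_eq_lintegral_rpow_enorm_toReal (by norm_num) (by norm_num)]
    refine ENNReal.rpow_lt_top_of_nonneg (by norm_num) (ne_of_lt ?_)
    have hlt : ∫⁻ x, ‖u t x‖ₑ ^ 2 < ⊤ := (hEb t htI).trans_lt hC₂
    simpa using hlt
  have hw := hasWeakGradient_fderiv_of_contDiff hcont
  calc eLpNorm (u t) 6 volume
      ≤ K * (∫⁻ x, ENNReal.ofReal (FluidPDE.frobeniusNormSq (fderiv ℝ (u t) x))) ^ (1 / 2 : ℝ) :=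
        hK _ _ h2 hw
    _ ≤ K * (B : ℝ≥0∞) ^ (1 / 2 : ℝ) := by
        gcongr
        exact hB t ht

/-- **Lemarié-Rieusset 2016, Thm. 11.4 ⇒ Thm. 7.2 (first point), forced, classical rendering.**
The forced Leray rate `lemarieRieusset2016_lerayRate_forced` (with `q = 6`) and the Sobolev
embedding `H¹(ℝ³) ⊂ L⁶(ℝ³)` imply the forced `H¹` continuation criterion
`lemarieRieusset2016_H1_continuation_forced`: if the enstrophy of a classical solution with Clay
data stays bounded up to `T`, then `‖u(t)‖_{L⁶}` stays bounded, so
`(T - t)^{1/4}‖u(t)‖_{L⁶} → 0`, which Leray's rate forbids for a maximal solution; hence `u` is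
not maximal at `T`, i.e. it extends classically past `T`.
[cite: LemarieRieusset2016, Thm. 11.4 (p. 327) and Thm. 7.2 (p. 125)] -/
theorem lemarieRieusset2016_H1_continuation_forced_of_lerayRate
    (h : lemarieRieusset2016_lerayRate_forced) : lemarieRieusset2016_H1_continuation_forced := by
  intro ν T hν hT f u p hsol hTao hTao' hE hu₀ hf hf' hH1
  by_contra hext
  have hmax : IsMaximalSmoothSolution ν f u p T := ⟨hsol, hext⟩
  obtain ⟨C, hC, hrate⟩ := h ν 6 hν (by norm_num)
  have hle := hrate hT hmax hTao hTao' hE hu₀ hf hf'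
  obtain ⟨B, hB⟩ := hH1
  obtain ⟨M, hMtop, h6⟩ := exists_eLpNorm_six_le_of_enstrophy_le hsol hE hB
  have hr0 : (0 : ℝ) < (1 - 3 / 6) / 2 := by norm_num
  -- eventual domination of the quantity inside Leray's `liminf`
  have hdom : ∀ᶠ t in 𝓝[<] T,
      ENNReal.ofReal ((T - t) ^ ((1 - 3 / 6) / 2 : ℝ)) * eLpNorm (u t) (ENNReal.ofReal 6) volume ≤
        ENNReal.ofReal ((T - t) ^ ((1 - 3 / 6) / 2 : ℝ)) * M := by
    filter_upwards [Ico_mem_nhdsLT hT] with t ht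
    have e6 : ENNReal.ofReal (6 : ℝ) = 6 := by norm_num
    rw [e6]
    gcongr
    exact h6 t ht
  -- the dominating quantity tends to `0` as `t → T⁻`
  have hlim : Tendsto (fun t => ENNReal.ofReal ((T - t) ^ ((1 - 3 / 6) / 2 : ℝ)) * M)
      (𝓝[<] T) (𝓝 0) := by
    have hc : Continuous fun t : ℝ => (T - t) ^ ((1 - 3 / 6) / 2 : ℝ) :=
      (continuous_const.sub continuous_id).rpow_const fun _ => Or.inr hr0.le
    have h1 : Tendsto (fun t : ℝ => (T - t) ^ ((1 - 3 / 6) / 2 : ℝ)) (𝓝[<] T) (𝓝 0) := by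
      have h1' := (hc.tendsto T).mono_left (nhdsWithin_le_nhds (s := Iio T))
      simpa [Real.zero_rpow hr0.ne'] using h1'
    have h2 := ENNReal.tendsto_ofReal h1
    rw [ENNReal.ofReal_zero] at h2
    simpa using ENNReal.Tendsto.mul_const h2 (Or.inr hMtop)
  have hlim0 : Filter.liminf (fun t => ENNReal.ofReal ((T - t) ^ ((1 - 3 / 6) / 2 : ℝ)) *
      eLpNorm (u t) (ENNReal.ofReal 6) volume) (𝓝[<] T) ≤ 0 :=
    calc Filter.liminf (fun t => ENNReal.ofReal ((T - t) ^ ((1 - 3 / 6) / 2 : ℝ)) *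
          eLpNorm (u t) (ENNReal.ofReal 6) volume) (𝓝[<] T)
        ≤ Filter.liminf (fun t => ENNReal.ofReal ((T - t) ^ ((1 - 3 / 6) / 2 : ℝ)) * M)
            (𝓝[<] T) := liminf_le_liminf hdom
      _ = 0 := hlim.liminf_eq
  have hC0 : ENNReal.ofReal C ≤ 0 := hle.trans hlim0
  rw [nonpos_iff_eq_zero, ENNReal.ofReal_eq_zero] at hC0
  exact (not_le.2 hC) hC0

/-- The composite in the shape a blow-up construction meets it: under the forced Leray rate, a
MAXIMAL classical solution with Clay data (Tao class on every closed sub-slab, finite energy,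
Schwartz datum, Clay force) has UNBOUNDED ENSTROPHY on `[0, T)` — Leray 1934's
`‖∇u(t)‖₂ → ∞` at the blow-up time, with a force.
[cite: LemarieRieusset2016, Thm. 11.4 (p. 327) and Thm. 7.2 (p. 125)] -/
theorem lemarieRieusset2016_lerayRate_forced.enstrophy_unbounded_of_maximal
    (h : lemarieRieusset2016_lerayRate_forced)
    {ν T : ℝ} (hν : 0 < ν) (hT : 0 < T)
    {f u : ℝ → EuclideanSpace ℝ (Fin 3) → EuclideanSpace ℝ (Fin 3)}
    {p : ℝ → EuclideanSpace ℝ (Fin 3) → ℝ}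
    (hmax : IsMaximalSmoothSolution ν f u p T)
    (hTao : ∀ T' ∈ Ioo 0 T, HasBoundedSobolevNormsOn (Icc 0 T') u)
    (hTao' : ∀ T' ∈ Ioo 0 T, HasBoundedSobolevNormsOn (Icc 0 T') (timeDerivWithin (Icc 0 T') u))
    (hE : ∀ T' ∈ Ioo 0 T, ∃ C : ℝ≥0∞, C < ⊤ ∧ ∀ t ∈ Icc 0 T', ∫⁻ x, ‖u t x‖ₑ ^ 2 ≤ C)
    (hu₀ : HasRapidSpatialDecay (u 0))
    (hf : IsSmoothOnHalfSpace f) (hf' : HasRapidSpaceTimeDecay f) :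
    ∀ B : ℝ≥0, ∃ t ∈ Ico 0 T,
      (B : ℝ≥0∞) < ∫⁻ x, ENNReal.ofReal (FluidPDE.frobeniusNormSq (fderiv ℝ (u t) x)) :=
  (lemarieRieusset2016_H1_continuation_forced_of_lerayRate h).enstrophy_unbounded_of_maximal
    hν hT hmax hTao hTao' hE hu₀ hf hf'

end Literature.Analysis.FluidPDE

end
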